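import Summits.CriticalPhenomena.CardyFormulaZ2.Theorems.CardyIKTransportIKMixedBoxCrossingDefectGlueDefs
import Summits.CriticalPhenomena.CardyFormulaZ2.Theorems.CardyIKTransportIKMixedBoxCrossingStubPolyDoubling

/-!
# Stub `stub_rowGlue` of the line `defect-closure-exploration` (crux `IKMixedBoxCrossing`,
# stmt-CriticalPhenomena-5911)

ROW GLUING (the Cauchy–Schwarz junction across the straight cut, every column pattern `S`):
`RowFactorisation → RowGluing`, i.e. `glueFirst² ≤ ν(R crossed vertically) · glueSecond` for the tall box
`R = [a, a+k) × [-h, h]` cut by the cell row `0`.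

PROOF (no integrals, no literature fact).
* GLUE EVENTS. For a column `i < k` let `E_i = upArm_i ∩ loArm_i ∩ {(a+i, 0) black}`. POINTWISE GLUE
  (`glue_subset`): on `E_i` the black path inside the upper half-box from `(a+i, 1)` to its top row, the two
  vertical edges through the black axis cell `(a+i, 0)` and the black path inside the lower half-box from
  `(a+i, -1)` to its bottom row concatenate inside `R` to a bottom–top crossing: `E_i ⊆ T := tbCross`.
* MOMENTS (`glueFirst_eq`, `glueSecond_eq`). The axis cylinders `C_ξ`, `ξ : Fin k → Bool`, partition the
  observables (`sum_real_inter_rowCyl`) and on `C_ξ` the axis colour events are all or nothing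
  (`real_inter_inter_rowCyl`); the arm events are measurable and determined by their half-boxes
  (`arm_mem_determinedOn`: an arm reads the colours of the box cells and the anti-diagonal flags of faces that
  are themselves box cells), so `RowFactorisation` turns `glueFirst` into `Σ_i ν(E_i)` and `glueSecond` into
  `Σ_{i,j} ν(E_i ∩ E_j)`.
* CAUCHY–SCHWARZ (`sq_sum_real_le`, abstract): for measurable `E_i ⊆ T`,
  `(Σ_i ν(E_i))² ≤ ν(T) Σ_{i,j} ν(E_i ∩ E_j)` — refine to the cylinders of the family `E` (weights
  `w_J = ν(T ∩ cyl_J)`, counts `c_J = #J`): the three quantities are `Σ_J c_J w_J`, `Σ_J w_J`,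
  `Σ_J c_J² w_J`, and the finite Cauchy–Schwarz inequality `Finset.sum_sq_le_sum_mul_sum_of_sq_le_mul`
  concludes.
-/

noncomputable section

namespace Summit.CriticalPhenomena.CardyFormulaZ2.Cruxes.IKMixedBoxCrossing.DefectClosureExploration

open scoped BigOperators Classical
open MeasureTheory Finset
open Literature.Probability.Percolation Literature.Probability.LatticeModels
open Summit.CriticalPhenomena.CardyFormulaZ2.Theorems.IKLinearTransport.PinnedDiagramExchange
  (Obs νmix blackEdges tbCross determinedOn isProbabilityMeasure_nuMix)
open Summit.CriticalPhenomena.CardyFormulaZ2.Theorems.IKLinearTransport.PinnedDiagramExchange.CouplingToLimits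
  (measurable_blackEdges mk_mem_blackEdges_iff)
open Summit.CriticalPhenomena.CardyFormulaZ2.Cruxes.IKMixedBoxCrossing.PairedMirrorExploration.PolyDoublingStub
  (mem_openCrossing_congr mk_mem_blackEdges_congr inter_mem_determinedOn)

namespace RowGlueStub

/-! ## §1 Partition by the cylinders of finitely many events; Cauchy–Schwarz for a count of events -/

section Abstract

variable {α : Type*} [MeasurableSpace α] (μ : Measure α) {k : ℕ} (E : Fin k → Set α)

/-- The cylinders `{x | ∀ l, x ∈ E l ↔ J l}` of finitely many measurable sets are measurable. -/
theorem measurableSet_cyl (hE : ∀ l, MeasurableSet (E l)) (J : Fin k → Bool) :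
    MeasurableSet {x | ∀ l, (x ∈ E l ↔ J l = true)} :=
  measurableSet_setOf.2 (Measurable.forall fun l => (hE l).mem.iff measurable_const)

/-- PARTITION BY CYLINDERS: the cylinders of `E` partition the space, so the masses of the traces of a
measurable set `D` on them add up to the mass of `D`. -/
theorem sum_real_inter_cyl [IsFiniteMeasure μ] (hE : ∀ l, MeasurableSet (E l)) {D : Set α}
    (hD : MeasurableSet D) :
    ∑ J : Fin k → Bool, μ.real (D ∩ {x | ∀ l, (x ∈ E l ↔ J l = true)}) = μ.real D := by
  have h : μ.real (⋃ J : Fin k → Bool, D ∩ {x | ∀ l, (x ∈ E l ↔ J l = true)}) =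
      ∑ J : Fin k → Bool, μ.real (D ∩ {x | ∀ l, (x ∈ E l ↔ J l = true)}) :=
    measureReal_iUnion_fintype
      (fun J K hJK => Set.disjoint_left.2 fun x hxJ hxK =>
        hJK (funext fun l => Bool.eq_iff_iff.2 ((hxJ.2 l).symm.trans (hxK.2 l))))
      fun J => hD.inter (measurableSet_cyl E hE J)
  rw [← h]
  congr 1
  ext x
  simp only [Set.mem_iUnion, Set.mem_inter_iff, Set.mem_setOf_eq]
  exact ⟨fun ⟨_, hx, _⟩ => hx,
    fun hx => ⟨fun l => decide (x ∈ E l), hx, fun l => decide_eq_true_iff.symm⟩⟩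

/-- On a cylinder of `E` the trace of `E i` is all or nothing. -/
theorem real_inter_inter_cyl (D : Set α) (i : Fin k) (J : Fin k → Bool) :
    μ.real (D ∩ E i ∩ {x | ∀ l, (x ∈ E l ↔ J l = true)}) =
      if J i = true then μ.real (D ∩ {x | ∀ l, (x ∈ E l ↔ J l = true)}) else 0 := by
  split_ifs with h
  · congr 1
    ext x
    simp only [Set.mem_inter_iff, Set.mem_setOf_eq]
    exact ⟨fun hx => ⟨hx.1.1, hx.2⟩, fun hx => ⟨⟨hx.1, (hx.2 i).2 h⟩, hx.2⟩⟩
  · have he : D ∩ E i ∩ {x | ∀ l, (x ∈ E l ↔ J l = true)} = ∅ :=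
      Set.subset_empty_iff.1 fun x hx => (h ((hx.2 i).1 hx.1.2)).elim
    rw [he, measureReal_empty]

/-- CAUCHY–SCHWARZ FOR A COUNT OF EVENTS inside `T`: `(Σ_i μ(E_i))² ≤ μ(T) Σ_{i,j} μ(E_i ∩ E_j)` when every
`E_i ⊆ T` — the second-moment bound `(E N)² = (E N·1_T)² ≤ E N² · μ(T)` for `N = Σ_i 1_{E_i}`, obtained by
refining to the cylinders of `E` (weights `w_J = μ(T ∩ cyl_J)`, counts `c_J = #J`) and the finite
Cauchy–Schwarz inequality. -/
theorem sq_sum_real_le [IsFiniteMeasure μ] (hE : ∀ l, MeasurableSet (E l)) {T : Set α}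
    (hT : MeasurableSet T) (hET : ∀ l, E l ⊆ T) :
    (∑ i, μ.real (E i)) ^ 2 ≤ μ.real T * ∑ i, ∑ j, μ.real (E i ∩ E j) := by
  obtain ⟨w, hw⟩ : ∃ w : (Fin k → Bool) → ℝ,
      ∀ J, μ.real (T ∩ {x | ∀ l, (x ∈ E l ↔ J l = true)}) = w J := ⟨_, fun _ => rfl⟩
  obtain ⟨c, hc⟩ : ∃ c : (Fin k → Bool) → ℝ,
      ∀ J, (∑ i : Fin k, if J i = true then (1 : ℝ) else 0) = c J := ⟨_, fun _ => rfl⟩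
  have hw0 : ∀ J, 0 ≤ w J := fun J => by rw [← hw]; exact measureReal_nonneg
  have hc0 : ∀ J, 0 ≤ c J := fun J => by rw [← hc]; exact sum_nonneg fun i _ => by positivity
  -- first moment `Σ_i μ(E_i) = Σ_J c_J w_J`
  have h1 : ∑ i, μ.real (E i) = ∑ J, c J * w J := by
    calc ∑ i, μ.real (E i) = ∑ i, ∑ J : Fin k → Bool, (if J i = true then w J else 0) := by
          refine sum_congr rfl fun i _ => ?_
          rw [← Set.inter_eq_right.2 (hET i), ← sum_real_inter_cyl μ E hE (hT.inter (hE i))]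
          simp only [real_inter_inter_cyl, hw]
      _ = ∑ J, c J * w J := by
          rw [sum_comm]
          simp only [← hc, sum_mul, ite_mul, one_mul, zero_mul]
  -- second moment `Σ_{i,j} μ(E_i ∩ E_j) = Σ_J c_J² w_J`
  have h2 : ∑ i, ∑ j, μ.real (E i ∩ E j) = ∑ J, c J * (c J * w J) := by
    calc ∑ i, ∑ j, μ.real (E i ∩ E j)
          = ∑ i, ∑ j, ∑ J : Fin k → Bool, (if J j = true then (if J i = true then w J else 0) else 0) := by
          refine sum_congr rfl fun i _ => sum_congr rfl fun j _ => ?_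
          rw [← Set.inter_eq_right.2 (Set.inter_subset_left.trans (hET i)), ← Set.inter_assoc,
            ← sum_real_inter_cyl μ E hE ((hT.inter (hE i)).inter (hE j))]
          simp only [real_inter_inter_cyl, hw]
      _ = ∑ J : Fin k → Bool, ∑ i, ∑ j, (if J j = true then (if J i = true then w J else 0) else 0) :=
          (sum_congr rfl fun _ _ => sum_comm).trans sum_comm
      _ = ∑ J, c J * (c J * w J) := by
          refine sum_congr rfl fun J _ => ?_
          simp only [← hc, sum_mul, mul_sum]
          refine sum_congr rfl fun i _ => sum_congr rfl fun j _ => ?_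
          by_cases hi : J i = true <;> by_cases hj : J j = true <;> simp [hi, hj]
  -- total mass `μ(T) = Σ_J w_J` and the finite Cauchy–Schwarz inequality
  calc (∑ i, μ.real (E i)) ^ 2 = (∑ J, c J * w J) ^ 2 := by rw [h1]
    _ ≤ (∑ J, w J) * ∑ J, c J * (c J * w J) :=
        sum_sq_le_sum_mul_sum_of_sq_le_mul _ (fun J _ => hw0 J)
          (fun J _ => mul_nonneg (hc0 J) (mul_nonneg (hc0 J) (hw0 J))) fun J _ => le_of_eq (by ring)
    _ = μ.real T * ∑ i, ∑ j, μ.real (E i ∩ E j) := by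
        rw [h2, ← sum_real_inter_cyl μ E hE hT]
        simp only [hw]

end Abstract

/-! ## §2 The axis cylinders and the arm events -/

/-- The colour of one cell is a measurable event of the observables. -/
theorem measurableSet_blk (v : Site 2) : MeasurableSet {x : Obs | v ∈ x.1} :=
  measurableSet_setOf.2 ((measurable_set_mem v).comp measurable_fst)

/-- The axis cylinders `C_ξ` partition the observables: `Σ_ξ ν(D ∩ C_ξ) = ν(D)`. -/
theorem sum_real_inter_rowCyl (S : Set ℤ) (a : ℤ) (k : ℕ) {D : Set Obs} (hD : MeasurableSet D) :
    ∑ ξ : Fin k → Bool, (νmix S).real (D ∩ rowCyl a k ξ) = (νmix S).real D := by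
  haveI := isProbabilityMeasure_nuMix S
  exact sum_real_inter_cyl (νmix S) (fun i : Fin k => {x : Obs | (![a + i, 0] : Site 2) ∈ x.1})
    (fun i => measurableSet_blk _) hD

/-- On the axis cylinder `C_ξ` the colour of the axis cell `(a+i, 0)` is `ξ_i`. -/
theorem real_inter_inter_rowCyl (S : Set ℤ) (a : ℤ) (k : ℕ) (D : Set Obs) (i : Fin k) (ξ : Fin k → Bool) :
    (νmix S).real (D ∩ {x : Obs | (![a + i, 0] : Site 2) ∈ x.1} ∩ rowCyl a k ξ) =
      if ξ i = true then (νmix S).real (D ∩ rowCyl a k ξ) else 0 :=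
  real_inter_inter_cyl (νmix S) (fun i : Fin k => {x : Obs | (![a + i, 0] : Site 2) ∈ x.1}) D i ξ

/-- An arm event "`c` is black and joined inside `X` to `Tgt` by a black path" is measurable. -/
theorem measurableSet_arm (X Tgt : Set (Site 2)) (c : Site 2) :
    MeasurableSet {x : Obs | c ∈ x.1 ∧ blackEdges x ∈ openCrossing X {c} Tgt} :=
  (measurableSet_setOf.2 ((measurable_set_mem _).comp measurable_fst)).inter
    (measurable_blackEdges (measurableSet_openCrossing_of_countable _ _ _))

/-- ARM EVENTS ARE BOX EVENTS: "`c` is black and joined inside `X` to `Tgt` by a black path" only reads the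
colours of the cells of `X` and the anti-diagonal flags consulted by the edges of `X` — the flag of the face
`u` for the main diagonal `u — u+(1,1)` and of the face `u+(0,-1)` for the anti-diagonal `u — u+(1,-1)` —
provided the latter faces are cells of `X` (true for the two half-boxes). -/
theorem arm_mem_determinedOn {X Tgt : Set (Site 2)} {c : Site 2}
    (hX : ∀ u ∈ X, ∀ v ∈ X, v = u + ![1, -1] → u + ![0, -1] ∈ X) :
    {x : Obs | c ∈ x.1 ∧ blackEdges x ∈ openCrossing X {c} Tgt} ∈ determinedOn X := by
  intro x y hxy
  refine (and_congr_left fun hq => ?_).trans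
    (and_congr_right fun _ => mem_openCrossing_congr fun u hu v hv => ?_)
  · obtain ⟨s, hs, t, -, hsX, -, -⟩ := hq
    rw [Set.mem_singleton_iff] at hs
    subst hs
    exact (hxy s hsX).1
  · exact mk_mem_blackEdges_congr (hxy u hu).1 (hxy v hv).1 (fun _ => (hxy u hu).2)
      (fun huv => (hxy _ (hX u hu v hv huv)).2) (fun _ => (hxy v hv).2) fun hvu => (hxy _ (hX v hv u hu hvu)).2

/-- The upper half-box contains the face read by each of its anti-diagonal edges. -/
theorem upBox_face (a : ℤ) (k h : ℕ) :
    ∀ u ∈ upBox a k h, ∀ v ∈ upBox a k h, v = u + ![1, -1] → u + ![0, -1] ∈ upBox a k h := by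
  intro u hu v hv huv
  subst huv
  simp only [upBox, Set.mem_setOf_eq, Pi.add_apply, Matrix.cons_val_zero, Matrix.cons_val_one] at hu hv ⊢
  omega

/-- The lower half-box contains the face read by each of its anti-diagonal edges. -/
theorem loBox_face (a : ℤ) (k h : ℕ) :
    ∀ u ∈ loBox a k h, ∀ v ∈ loBox a k h, v = u + ![1, -1] → u + ![0, -1] ∈ loBox a k h := by
  intro u hu v hv huv
  subst huv
  simp only [loBox, Set.mem_setOf_eq, Pi.add_apply, Matrix.cons_val_zero, Matrix.cons_val_one] at hu hv ⊢
  omega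

/-- The upper arm event is measurable. -/
theorem measurableSet_upArm {a : ℤ} {k h : ℕ} {i : Fin k} : MeasurableSet (upArm a k h i) :=
  measurableSet_arm (upBox a k h) (upTop a k h) ![a + i, 1]

/-- The lower arm event is measurable. -/
theorem measurableSet_loArm {a : ℤ} {k h : ℕ} {i : Fin k} : MeasurableSet (loArm a k h i) :=
  measurableSet_arm (loBox a k h) (loBot a k h) ![a + i, -1]

/-- The upper arm event is determined by the upper half-box. -/
theorem upArm_mem {a : ℤ} {k h : ℕ} {i : Fin k} : upArm a k h i ∈ determinedOn (upBox a k h) :=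
  arm_mem_determinedOn (X := upBox a k h) (Tgt := upTop a k h) (c := ![a + i, 1]) (upBox_face a k h)

/-- The lower arm event is determined by the lower half-box. -/
theorem loArm_mem {a : ℤ} {k h : ℕ} {i : Fin k} : loArm a k h i ∈ determinedOn (loBox a k h) :=
  arm_mem_determinedOn (X := loBox a k h) (Tgt := loBot a k h) (c := ![a + i, -1]) (loBox_face a k h)

/-! ## §3 Pointwise glue -/

/-- POINTWISE GLUE: an upper arm at column `i`, the black axis cell `(a+i, 0)` and a lower arm at column `i`
concatenate (through the two vertical edges at the axis cell, present in every triangulation) to a bottom–top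
crossing of the tall box `[a, a+k) × [-h, h]`. -/
theorem glue_subset (a : ℤ) (k h : ℕ) (i : Fin k) :
    upArm a k h i ∩ loArm a k h i ∩ {x | (![a + i, 0] : Site 2) ∈ x.1} ⊆
      tbCross a (-(h : ℤ)) k (2 * h + 1) := by
  rintro x ⟨⟨⟨hb1, s, hs, t, ht, hst⟩, hb2, s', hs', t', ht', hst'⟩, h0⟩
  rw [Set.mem_singleton_iff] at hs hs'
  subst hs hs'
  have hik : (i : ℕ) < k := i.isLt
  have hh : (1 : ℤ) ≤ h := by
    obtain ⟨hs1, -, -⟩ := hst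
    have := hs1.2.2.2
    simpa using this
  set R : Set (Site 2) :=
    {v | a ≤ v 0 ∧ v 0 < a + k ∧ -(h : ℤ) ≤ v 1 ∧ v 1 < -(h : ℤ) + ((2 * h + 1 : ℕ) : ℤ)} with hR
  have hU : upBox a k h ⊆ R := fun v hv => by
    simp only [upBox, hR, Set.mem_setOf_eq] at hv ⊢; push_cast; omega
  have hL : loBox a k h ⊆ R := fun v hv => by
    simp only [loBox, hR, Set.mem_setOf_eq] at hv ⊢; push_cast; omega
  have hm : ∀ m : ℤ, -1 ≤ m → m ≤ 1 → (![a + i, m] : Site 2) ∈ R := fun m hm1 hm2 => by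
    simp only [hR, Set.mem_setOf_eq, Matrix.cons_val_zero, Matrix.cons_val_one]
    push_cast; omega
  have e1 : s(![a + i, 0], ![a + i, 1]) ∈ blackEdges x :=
    (mk_mem_blackEdges_iff _ _ _).2 (Or.inl ⟨h0, hb1, Or.inr (Or.inl (by ext j; fin_cases j <;> simp))⟩)
  have e2 : s(![a + i, -1], ![a + i, 0]) ∈ blackEdges x :=
    (mk_mem_blackEdges_iff _ _ _).2 (Or.inl ⟨hb2, h0, Or.inr (Or.inl (by ext j; fin_cases j <;> simp))⟩)
  have ne1 : (![a + i, 0] : Site 2) ≠ ![a + i, 1] := fun e => by simpa using congrFun e 1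
  have ne2 : (![a + i, -1] : Site 2) ≠ ![a + i, 0] := fun e => by simpa using congrFun e 1
  have c1 : blackEdges x ∈ openConnIn R t' ![a + i, -1] := by
    rw [openConnIn_comm]; exact openConnIn_mono hL _ _ hst'
  have c2 : blackEdges x ∈ openConnIn R ![a + i, -1] ![a + i, 0] :=
    openConnIn_of_adj (hm (-1) (by norm_num) (by norm_num)) (hm 0 (by norm_num) (by norm_num)) e2 ne2
  have c3 : blackEdges x ∈ openConnIn R ![a + i, 0] ![a + i, 1] :=
    openConnIn_of_adj (hm 0 (by norm_num) (by norm_num)) (hm 1 (by norm_num) (by norm_num)) e1 ne1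
  have c4 : blackEdges x ∈ openConnIn R ![a + i, 1] t := openConnIn_mono hU _ _ hst
  refine ⟨t', ht', t, ?_, PlanarDuality.openConnIn_trans (PlanarDuality.openConnIn_trans c1 c2)
    (PlanarDuality.openConnIn_trans c3 c4)⟩
  simp only [upTop, Set.mem_setOf_eq] at ht ⊢
  push_cast
  omega

/-! ## §4 The two moments -/

/-- FIRST MOMENT: by `RowFactorisation`, `glueFirst = Σ_i ν(upArm_i ∩ loArm_i ∩ {(a+i,0) black})`. -/
theorem glueFirst_eq (hRF : RowFactorisation) (S : Set ℤ) (a : ℤ) (k h : ℕ) :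
    glueFirst S a k h =
      ∑ i : Fin k, (νmix S).real (upArm a k h i ∩ loArm a k h i ∩ {x | (![a + i, 0] : Site 2) ∈ x.1}) := by
  refine sum_congr rfl fun i _ => ?_
  rw [← sum_real_inter_rowCyl S a k
    ((measurableSet_upArm.inter measurableSet_loArm).inter (measurableSet_blk _))]
  refine sum_congr rfl fun ξ _ => ?_
  rw [real_inter_inter_rowCyl,
    hRF S a k h _ _ measurableSet_upArm measurableSet_loArm upArm_mem loArm_mem ξ]

/-- SECOND MOMENT: by `RowFactorisation`, `glueSecond = Σ_{i,j} ν(E_i ∩ E_j)` for the glue events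
`E_i = upArm_i ∩ loArm_i ∩ {(a+i,0) black}`. -/
theorem glueSecond_eq (hRF : RowFactorisation) (S : Set ℤ) (a : ℤ) (k h : ℕ) :
    glueSecond S a k h =
      ∑ i : Fin k, ∑ j : Fin k, (νmix S).real
        (upArm a k h i ∩ loArm a k h i ∩ {x | (![a + i, 0] : Site 2) ∈ x.1} ∩
          (upArm a k h j ∩ loArm a k h j ∩ {x | (![a + j, 0] : Site 2) ∈ x.1})) := by
  refine sum_congr rfl fun i _ => sum_congr rfl fun j _ => ?_
  rw [← sum_real_inter_rowCyl S a k
    (((measurableSet_upArm.inter measurableSet_loArm).inter (measurableSet_blk _)).inter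
      ((measurableSet_upArm.inter measurableSet_loArm).inter (measurableSet_blk _)))]
  refine sum_congr rfl fun ξ _ => ?_
  rw [show upArm a k h i ∩ loArm a k h i ∩ {x | (![a + i, 0] : Site 2) ∈ x.1} ∩
      (upArm a k h j ∩ loArm a k h j ∩ {x | (![a + j, 0] : Site 2) ∈ x.1}) ∩ rowCyl a k ξ =
      upArm a k h i ∩ upArm a k h j ∩ (loArm a k h i ∩ loArm a k h j) ∩
        {x | (![a + i, 0] : Site 2) ∈ x.1} ∩ {x | (![a + j, 0] : Site 2) ∈ x.1} ∩ rowCyl a k ξ from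
      Set.ext fun x => by simp only [Set.mem_inter_iff]; tauto,
    real_inter_inter_rowCyl, real_inter_inter_rowCyl,
    hRF S a k h _ _ (measurableSet_upArm.inter measurableSet_upArm) (measurableSet_loArm.inter measurableSet_loArm)
      (inter_mem_determinedOn upArm_mem upArm_mem) (inter_mem_determinedOn loArm_mem loArm_mem) ξ]
  by_cases hi : ξ i = true <;> by_cases hj : ξ j = true <;> simp [hi, hj]

end RowGlueStub

/-- **Registered stub `stub_rowGlue`** (ROW GLUING, line `defect-closure-exploration`): the second-moment
junction across the straight cut, for every column pattern `S` — with `M` the number of columns `i` carrying an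
upper arm, a black axis cell and a lower arm (each such column glues a vertical crossing of
`R = [a, a+k) × [-h, h]`), Cauchy–Schwarz `(E M)² ≤ E M² · ν(R crossed vertically)` and `RowFactorisation`
(which makes both moments the explicit sums `glueFirst`, `glueSecond`) give
`glueFirst² ≤ ν(tbCross a (-h) k (2h+1)) · glueSecond`. -/
theorem stub_rowGlue : RowFactorisation → RowGluing := by
  intro hRF S a k h
  haveI := isProbabilityMeasure_nuMix S
  have hT : MeasurableSet (tbCross a (-(h : ℤ)) k (2 * h + 1)) := by
    unfold tbCross
    exact measurable_blackEdges (measurableSet_openCrossing_of_countable _ _ _)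
  rw [RowGlueStub.glueFirst_eq hRF, RowGlueStub.glueSecond_eq hRF]
  exact RowGlueStub.sq_sum_real_le (νmix S)
    (fun i : Fin k => upArm a k h i ∩ loArm a k h i ∩ {x | (![a + i, 0] : Site 2) ∈ x.1})
    (fun i => (RowGlueStub.measurableSet_upArm.inter RowGlueStub.measurableSet_loArm).inter
      (RowGlueStub.measurableSet_blk _))
    hT (RowGlueStub.glue_subset a k h)

end Summit.CriticalPhenomena.CardyFormulaZ2.Cruxes.IKMixedBoxCrossing.DefectClosureExploration

end
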